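import Summits.QuantumFields.YangMills.Theorems.BalabanUVNodesN08AlphaThreeFaces

/-!
# Route «BalabanUVNodes», Track-A DAG node N08 = [Balaban1985UV3] — (α) clause: the size condition `4π ≤ min C68 (2L²B₃)` of the in-edge END is MET by
# enlarging two O(1) names of the record (`bump68`)

Cell `pub-ymgap`, seat `pub-ymgap-dag-n08-d` gen 5, file F11 (beside F8–F10 `…ProfileThreshold ∕ …ProfileRecord ∕ …ProfileGroupSU`).  `bears_on: R4∕N08`; filed
`--supports stmt-QuantumFields-19910 --as helper`.  Sorry-free, standard axioms.

After F8–F10 the in-edge side of the (α) clause carries, for `SU(N)` (`N ≥ 2`), ONE condition on the constants record: `4π ≤ (regMin 𝔠).C68 = min C68 (2L²B₃)`.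
It is a SIZE condition on two O(1) names (the constant of (68) p. 273 and [7]'s `B₃` of (44) p. 267 — upper-bound constants, so enlarging them weakens nothing
they assert), met by the record `bump68 𝔠 := {𝔠 with C68 := max C68 4π, B₃ := max B₃ 2π}`: `four_pi_le_regMin_bump68`.  Every other primitive field is
`𝔠`'s; the lane's CARRIER constants (histories, collars, blocks, `b₀, p₀`) are unchanged (`bump68_carrier`, `rfl`); `B₃` propagates only into the O(1) `C46` of (46)
(larger) and the leaf thresholds `γ₄₆, γ_OO` (hence `γ₀`, `γ_N08`, `γ_N08^d` shrink).
HONEST FRAMING: bookkeeping on the constants record; nothing of [B10] asserted; count-neutral; NOT a discharge of N08.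
-/

noncomputable section

namespace Summit.QuantumFields.YangMills.Theorems.BalabanUVNodesN08AlphaProfileConsts

open Summit.QuantumFields.Balaban3D.Proofs.Primitives (AlphaConsts)
open Summit.QuantumFields.YangMills.Theorems.BalabanUVNodesN08AlphaThreeFaces (regMin regMin_C68)

variable {L N : ℕ} (𝔠 : AlphaConsts L N)

/-- **THE BUMPED RECORD** `bump68 𝔠`: `C68 := max C68 4π`, `B₃ := max B₃ 2π`, every other field `𝔠`'s. [cite: Balaban1985UV3, (68) p.273 + (44) p.267] -/
def bump68 : AlphaConsts L N :=
  { 𝔠 with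
    B₃ := max 𝔠.B₃ (2 * Real.pi)
    C68 := max 𝔠.C68 (4 * Real.pi)
    B₃_pos := lt_max_of_lt_left 𝔠.B₃_pos
    C68_pos := lt_max_of_lt_left 𝔠.C68_pos }

/-- The bumped fields. [folklore] -/
theorem bump68_C68_B₃ : (bump68 𝔠).C68 = max 𝔠.C68 (4 * Real.pi) ∧ (bump68 𝔠).B₃ = max 𝔠.B₃ (2 * Real.pi) := ⟨rfl, rfl⟩

/-- The bump enlarges: `C68 ≤ C68⁺`, `B₃ ≤ B₃⁺`. [folklore] -/
theorem le_bump68 : 𝔠.C68 ≤ (bump68 𝔠).C68 ∧ 𝔠.B₃ ≤ (bump68 𝔠).B₃ := ⟨le_max_left _ _, le_max_left _ _⟩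

/-- The lane's CARRIER constants (histories, collars `⌈R₁r(g)⌉M₁`, big blocks, `b₀, p₀, r₀, R₁, M₁, κ₀`, the booked profiles) are UNCHANGED by the bump
(`B₃` enters the lane's record only through the O(1) `C46` of (46), which grows). [folklore] -/
theorem bump68_carrier : (bump68 𝔠).lane.carrier = 𝔠.lane.carrier ∧ (bump68 𝔠).b₀ = 𝔠.b₀ ∧ (bump68 𝔠).p₀ = 𝔠.p₀ :=
  ⟨rfl, rfl, rfl⟩

/-- **THE SIZE CONDITION OF THE IN-EDGE END IS MET BY THE BUMPED RECORD**: `4π ≤ (regMin (bump68 𝔠)).C68 = min (max C68 4π) (2L²·max B₃ 2π)` (`L ≥ 1`).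
[cite: Balaban1985UV3, (68) p.273 + (44) p.267] -/
theorem four_pi_le_regMin_bump68 : 4 * Real.pi ≤ (regMin (bump68 𝔠)).C68 := by
  rw [regMin_C68, (bump68_C68_B₃ 𝔠).1, (bump68_C68_B₃ 𝔠).2]
  have hL : (1 : ℝ) ≤ L := by exact_mod_cast le_of_lt 𝔠.one_lt_L
  have hL2 : (1 : ℝ) ≤ (L : ℝ) ^ 2 := by nlinarith
  have hπ := Real.pi_pos
  refine le_min (le_max_right _ _) ?_
  calc 4 * Real.pi = 2 * 1 * (2 * Real.pi) := by ring
    _ ≤ 2 * (L : ℝ) ^ 2 * max 𝔠.B₃ (2 * Real.pi) :=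
        mul_le_mul (by linarith) (le_max_right _ _) (by positivity) (by positivity)

/-- Hence records meeting the condition, with the same carrier constants, EXIST as soon as records do. [folklore] -/
theorem exists_four_pi_le_regMin : ∃ 𝔠' : AlphaConsts L N, 𝔠'.lane.carrier = 𝔠.lane.carrier ∧ 4 * Real.pi ≤ (regMin 𝔠').C68 :=
  ⟨bump68 𝔠, (bump68_carrier 𝔠).1, four_pi_le_regMin_bump68 𝔠⟩

end Summit.QuantumFields.YangMills.Theorems.BalabanUVNodesN08AlphaProfileConsts

end
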